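import Summits.QuantumFields.YangMills.Theorems.BalabanLadderUVSeamRecCeilingsResponseCarriersLocal
import Summits.QuantumFields.YangMills.Theorems.BalabanLadderUVSeamRecPolymerInfluence
import HarnessLib

/-!
# Crux `UVSeamRec` (stmt-QuantumFields-20043): the (β) press-button with tempered-d1's TYPED large-field carrier —
# (split with `Q + influenceAt`) + (EM_Q) + «weights, density budget and product law for the `largeFieldEvent` gas» ⇒ (RM)

Helper file (`--supports stmt-QuantumFields-20043`) of the width-lever seat `ym-20043-ceilings-p2` (lane B, gen 2).  It wires tempered-d1's
LANDED vocabulary of the (β) discharge architecture — the multiscale influence functional `PolymerData.influenceAt 𝔟 ε kmax` (p533172) over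
the block-averaged large-field events `largeFieldEvent` (p531519), with its bookkeeping lemmas `measurable_influenceAt`, `abs_influenceAt_le`,
`influenceAt_le_familySum` (domination (i)) and `familyCoeff_clause_ii` (Λ = 1) — into the carriers press-button
`responseMoments_of_quadratic_and_polymerLaw_local` (this seat).  What remains OPEN of the large-field half is then stated in D1's own letters:
per odd torus and separated family, nonnegative WEIGHTS `w γ` on the family shell with a uniform DENSITY BUDGET `Σ_γ familyCoeff i γ · w γ ≤ W`
and the PRODUCT LAW `⟨∏_{γ∈A} 1_{largeFieldEvent γ}∘lift⟩_{2L+1,β} ≤ ∏_{γ∈A} w γ` — a Bałaban-type multiscale large-field estimate (level 0 is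
the tree's p530009 via p534572).  HONEST FRAMING: composition only; (split), (EM_Q) and the block-level product law are OPEN; nothing of E0′;
not a gap, not Clay.

* `responseMoments_of_quadratic_and_influence` — `SU(N)`, any lattice representation, any unit: ⇒ (RM) with `B = A₀ + max(B_Q, 2e²W)`.
* `responseMomentsOdd6_of_quadratic_and_influence` — at the registered v5(α) stub (`SU(2)`, `fundamentalLatticeRep 2`, `Transport.uRec`):
  conclusion = the body of `BirthV5A.stub_responseMomentsOdd6` verbatim.

References: as p535725 (Georgii (2011) Thm. 4.17 for the DLR part); T. Bałaban, Commun. Math. Phys. 122 (1989) 355–392 for the intended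
supplier of the product law.
-/

set_option autoImplicit false

noncomputable section

open MeasureTheory Filter Topology Finset
open Literature.Probability.LatticeModels
open Literature.MathematicalPhysics.QuantumFieldTheory (GaugeConfig LatticeRep)
open Literature.MathematicalPhysics.QuantumLattice

namespace Summit.QuantumFields.YangMills.Cruxes.UVSeamRec.TemperedResponse

open Summit.QuantumFields.YangMills.Cruxes.OSLegsFromFemtoAndGap.DlrCollarTransfer
open Summit.QuantumFields.YangMills.Cruxes.UVSeamRec.PolymerData

section Influence

variable {N : ℕ} [NeZero N]

/-- **(RM) from a quadratic carrier and tempered-d1's influence functional.**  Structure group `SU(N)`, any lattice representation `r`, unit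
`a`; block size `𝔟`, per-level thresholds `ε β k`, level cutoff `kmax β R`.  Hypotheses: (split) for ALL exteriors,
`(R⁴/C₁)|kerE − p| ≤ A₀ + Q β R q x η + influenceAt 𝔟 ε kmax β R q x η`; (EM_Q) doubled joint exponential moments of `Q`; and, per odd torus
`2L+1` and cyclically separated family, WEIGHTS `w γ ≥ 0` on `familyShell 𝔟 (kmax β R) R x` with density budget
`Σ_γ familyCoeff 𝔟 (kmax β R) R x i γ · w γ ≤ W` (all `i`) and the product law
`torusE(∏_{γ∈A} 1_{largeFieldEvent 𝔟 (ε β γ.k) γ}) ≤ ∏_{γ∈A} w γ` (all `A ⊆ familyShell`).  THEN (RM) VERBATIM with `B = A₀ + max(B_Q, 2e²W)`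
(Λ = 1 by tempered-d1's `familyCoeff_clause_ii`). [folklore] -/
theorem responseMoments_of_quadratic_and_influence (r : LatticeRep (Matrix.specialUnitaryGroup (Fin N) ℂ)) (a : ℝ → ℝ)
    (𝔟 : BlockSize) (ε : ℝ → ℕ → ℝ) (kmax : ℝ → ℕ → ℕ) {C₁ β₁ ℓ₁ A₀ B_Q W : ℝ} {p : Fin 4 × Fin 4 → ℝ → ℝ}
    (Q : ℝ → ℕ → Fin 4 × Fin 4 → (Fin 4 → ℤ) → LGConfig 4 (Matrix.specialUnitaryGroup (Fin N) ℂ) → ℝ)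
    (MQ : ℝ → ℕ → Fin 4 × Fin 4 → (Fin 4 → ℤ) → ℝ)
    (hQm : ∀ β R q x, Measurable (Q β R q x)) (hQb : ∀ β R q x η, |Q β R q x η| ≤ MQ β R q x)
    (hsplit : ∀ β : ℝ, β₁ ≤ β → ∀ R : ℕ, 1 ≤ R → (R : ℝ) * a β ≤ ℓ₁ →
      ∀ (q : Fin 4 × Fin 4) (x : Fin 4 → ℤ), q.1 < q.2 → ∀ η : LGConfig 4 (Matrix.specialUnitaryGroup (Fin N) ℂ),
        (R : ℝ) ^ 4 / C₁ * |kerE (Matrix.specialUnitaryGroup (Fin N) ℂ) r β (fun k => x k - (R + 1)) (2 * R + 3) η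
          (plane (Matrix.specialUnitaryGroup (Fin N) ℂ) r q x) - p q β| ≤
          A₀ + Q β R q x η + influenceAt (N := N) 𝔟 ε kmax β R q x η)
    (hEMQ : ∀ β : ℝ, β₁ ≤ β → ∀ (L n : ℕ) (q : Fin n → Fin 4 × Fin 4) (x : Fin n → (Fin 4 → ℤ)) (R : ℕ),
      (∀ i, (q i).1 < (q i).2) → 1 ≤ R → (R : ℝ) * a β ≤ ℓ₁ → 4 * R + 8 ≤ L →
      (∀ i j : Fin n, i ≠ j → ∃ k : Fin 4,
        (2 * (R : ℤ) + 4) ≤ |((((x i k - x j k : ℤ) : ZMod (2 * L + 1))).valMinAbs : ℤ)|) →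
      ∀ T : Finset (Fin n),
        torusE (Matrix.specialUnitaryGroup (Fin N) ℂ) r β L
          (fun U => Real.exp (((2 : ℕ) : ℝ) * ∑ i ∈ T, Q β R (q i) (x i) U)) ≤ Real.exp (B_Q * T.card))
    (hW : ∀ β : ℝ, β₁ ≤ β → ∀ (L n : ℕ) (q : Fin n → Fin 4 × Fin 4) (x : Fin n → (Fin 4 → ℤ)) (R : ℕ),
      (∀ i, (q i).1 < (q i).2) → 1 ≤ R → (R : ℝ) * a β ≤ ℓ₁ → 4 * R + 8 ≤ L →
      (∀ i j : Fin n, i ≠ j → ∃ k : Fin 4,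
        (2 * (R : ℤ) + 4) ≤ |((((x i k - x j k : ℤ) : ZMod (2 * L + 1))).valMinAbs : ℤ)|) →
      ∃ w : Polymer → ℝ, (∀ γ ∈ familyShell 𝔟 (kmax β R) R x, 0 ≤ w γ) ∧
        (∀ i, ∑ γ ∈ familyShell 𝔟 (kmax β R) R x, familyCoeff 𝔟 (kmax β R) R x i γ * w γ ≤ W) ∧
        (∀ A, A ⊆ familyShell 𝔟 (kmax β R) R x →
          torusE (Matrix.specialUnitaryGroup (Fin N) ℂ) r β L (fun U => ∏ γ ∈ A,
            (largeFieldEvent (N := N) 𝔟 (ε β γ.k) γ).indicator (fun _ => (1 : ℝ)) U) ≤ ∏ γ ∈ A, w γ)) :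
    ∀ β : ℝ, β₁ ≤ β → ∀ (L n : ℕ) (q : Fin n → Fin 4 × Fin 4) (x : Fin n → (Fin 4 → ℤ)) (R : ℕ),
      (∀ i, (q i).1 < (q i).2) → 1 ≤ R → (R : ℝ) * a β ≤ ℓ₁ → 4 * R + 8 ≤ L →
      (∀ i j : Fin n, i ≠ j → ∃ k : Fin 4,
        (2 * (R : ℤ) + 4) ≤ |((((x i k - x j k : ℤ) : ZMod (2 * L + 1))).valMinAbs : ℤ)|) →
      ∀ T : Finset (Fin n),
        torusE (Matrix.specialUnitaryGroup (Fin N) ℂ) r β L (fun U => Real.exp (∑ i ∈ T, (R : ℝ) ^ 4 / C₁ *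
          |kerE (Matrix.specialUnitaryGroup (Fin N) ℂ) r β (fun k => x i k - (R + 1)) (2 * R + 3) U
            (plane (Matrix.specialUnitaryGroup (Fin N) ℂ) r (q i) (x i)) - p (q i) β|)) ≤
          Real.exp ((A₀ + max B_Q (2 * Real.exp (2 * 1) * W)) * T.card) := by
  refine responseMoments_of_quadratic_and_polymerLaw_local r a Q (influenceAt (N := N) 𝔟 ε kmax)
    (fun β R q x => max (MQ β R q x) (coeffMass 𝔟 (kmax β R) R x)) hQm
    (fun β R q x η => (hQb β R q x η).trans (le_max_left _ _))
    (fun β R q x => measurable_influenceAt (N := N) 𝔟 ε kmax β R q x)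
    (fun β R q x η => (abs_influenceAt_le (N := N) 𝔟 ε kmax β R q x η).trans (le_max_right _ _)) hsplit hEMQ ?_
  intro β hβ L n q x R hq hR hRa hRL hsep
  obtain ⟨w, hw0, hwW, hpl⟩ := hW β hβ L n q x R hq hR hRa hRL hsep
  exact ⟨Polymer, familyShell 𝔟 (kmax β R) R x, fun γ => largeFieldEvent (N := N) 𝔟 (ε β γ.k) γ, w,
    familyCoeff 𝔟 (kmax β R) R x, fun γ => measurableSet_largeFieldEvent (N := N) 𝔟 _ γ, hw0,
    fun i γ _ => familyCoeff_nonneg 𝔟 (kmax β R) R x i γ,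
    fun i U => influenceAt_le_familySum (N := N) 𝔟 ε kmax β R L q x i U,
    familyCoeff_clause_ii 𝔟 (kmax β R) R x hsep, hwW, hpl⟩

end Influence

/-! ## At the registered stub (SU(2), fundamental representation, unit of record) -/

section Unit

/-- **The body of `stub_responseMomentsOdd6` from the (β) split with tempered-d1's influence functional.**  `SU(2)`, fundamental
representation, a unit `a ≤ c·uRec` eventually: (split with `Q + influenceAt 𝔟 ε kmax`) + (EM_Q) + (weights, density budget `W` and product
law for the `largeFieldEvent` gas on every odd torus) ⇒ the registered conclusion with `B = A₀ + max(B_Q, 2e²W)`.  A closer along (β) ends with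
`exact responseMomentsOdd6_of_quadratic_and_influence …`. [folklore] -/
theorem responseMomentsOdd6_of_quadratic_and_influence {a : ℝ → ℝ} {c C₁ β₁ ℓ₁ A₀ B_Q W P₀ : ℝ}
    {p : Fin 4 × Fin 4 → ℝ → ℝ} (hc : 0 < c) (hle : ∀ᶠ β in atTop, a β ≤ c * Transport.uRec β) (hℓ₁ : 0 < ℓ₁)
    (hC₁ : 0 < C₁) (hp : ∀ q β, |p q β| ≤ P₀) (𝔟 : BlockSize) (ε : ℝ → ℕ → ℝ) (kmax : ℝ → ℕ → ℕ)
    (Q : ℝ → ℕ → Fin 4 × Fin 4 → (Fin 4 → ℤ) → LGConfig 4 (Matrix.specialUnitaryGroup (Fin 2) ℂ) → ℝ)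
    (MQ : ℝ → ℕ → Fin 4 × Fin 4 → (Fin 4 → ℤ) → ℝ)
    (hQm : ∀ β R q x, Measurable (Q β R q x)) (hQb : ∀ β R q x η, |Q β R q x η| ≤ MQ β R q x)
    (hsplit : ∀ β : ℝ, β₁ ≤ β → ∀ R : ℕ, 1 ≤ R → (R : ℝ) * a β ≤ ℓ₁ →
      ∀ (q : Fin 4 × Fin 4) (x : Fin 4 → ℤ), q.1 < q.2 → ∀ η : LGConfig 4 (Matrix.specialUnitaryGroup (Fin 2) ℂ),
        (R : ℝ) ^ 4 / C₁ * |kerE (Matrix.specialUnitaryGroup (Fin 2) ℂ) (fundamentalLatticeRep 2) β (fun k => x k - (R + 1))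
          (2 * R + 3) η (plane (Matrix.specialUnitaryGroup (Fin 2) ℂ) (fundamentalLatticeRep 2) q x) - p q β| ≤
          A₀ + Q β R q x η + influenceAt (N := 2) 𝔟 ε kmax β R q x η)
    (hEMQ : ∀ β : ℝ, β₁ ≤ β → ∀ (L n : ℕ) (q : Fin n → Fin 4 × Fin 4) (x : Fin n → (Fin 4 → ℤ)) (R : ℕ),
      (∀ i, (q i).1 < (q i).2) → 1 ≤ R → (R : ℝ) * a β ≤ ℓ₁ → 4 * R + 8 ≤ L →
      (∀ i j : Fin n, i ≠ j → ∃ k : Fin 4,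
        (2 * (R : ℤ) + 4) ≤ |((((x i k - x j k : ℤ) : ZMod (2 * L + 1))).valMinAbs : ℤ)|) →
      ∀ T : Finset (Fin n),
        torusE (Matrix.specialUnitaryGroup (Fin 2) ℂ) (fundamentalLatticeRep 2) β L
          (fun U => Real.exp (((2 : ℕ) : ℝ) * ∑ i ∈ T, Q β R (q i) (x i) U)) ≤ Real.exp (B_Q * T.card))
    (hW : ∀ β : ℝ, β₁ ≤ β → ∀ (L n : ℕ) (q : Fin n → Fin 4 × Fin 4) (x : Fin n → (Fin 4 → ℤ)) (R : ℕ),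
      (∀ i, (q i).1 < (q i).2) → 1 ≤ R → (R : ℝ) * a β ≤ ℓ₁ → 4 * R + 8 ≤ L →
      (∀ i j : Fin n, i ≠ j → ∃ k : Fin 4,
        (2 * (R : ℤ) + 4) ≤ |((((x i k - x j k : ℤ) : ZMod (2 * L + 1))).valMinAbs : ℤ)|) →
      ∃ w : Polymer → ℝ, (∀ γ ∈ familyShell 𝔟 (kmax β R) R x, 0 ≤ w γ) ∧
        (∀ i, ∑ γ ∈ familyShell 𝔟 (kmax β R) R x, familyCoeff 𝔟 (kmax β R) R x i γ * w γ ≤ W) ∧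
        (∀ A, A ⊆ familyShell 𝔟 (kmax β R) R x →
          torusE (Matrix.specialUnitaryGroup (Fin 2) ℂ) (fundamentalLatticeRep 2) β L (fun U => ∏ γ ∈ A,
            (largeFieldEvent (N := 2) 𝔟 (ε β γ.k) γ).indicator (fun _ => (1 : ℝ)) U) ≤ ∏ γ ∈ A, w γ)) :
    ∃ (a : ℝ → ℝ) (c : ℝ) (C₁ B β₁ ℓ₁ P₀ : ℝ) (p : Fin 4 × Fin 4 → ℝ → ℝ), 0 < c ∧
      (∀ᶠ β in atTop, a β ≤ c * Transport.uRec β) ∧ 0 < ℓ₁ ∧ 0 < C₁ ∧ (∀ q β, |p q β| ≤ P₀) ∧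
      ∀ β : ℝ, β₁ ≤ β → ∀ (L n : ℕ) (q : Fin n → Fin 4 × Fin 4) (x : Fin n → (Fin 4 → ℤ)) (R : ℕ),
        (∀ i, (q i).1 < (q i).2) → 1 ≤ R → (R : ℝ) * a β ≤ ℓ₁ → 4 * R + 8 ≤ L →
        (∀ i j : Fin n, i ≠ j → ∃ k : Fin 4,
          (2 * (R : ℤ) + 4) ≤ |((((x i k - x j k : ℤ) : ZMod (2 * L + 1))).valMinAbs : ℤ)|) →
        ∀ T : Finset (Fin n),
          torusE (Matrix.specialUnitaryGroup (Fin 2) ℂ) (fundamentalLatticeRep 2) β L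
            (fun U => Real.exp (∑ i ∈ T, (R : ℝ) ^ 4 / C₁ *
              |kerE (Matrix.specialUnitaryGroup (Fin 2) ℂ) (fundamentalLatticeRep 2) β (fun k => x i k - (R + 1)) (2 * R + 3) U
                (plane (Matrix.specialUnitaryGroup (Fin 2) ℂ) (fundamentalLatticeRep 2) (q i) (x i)) - p (q i) β|)) ≤
            Real.exp (B * T.card) :=
  ⟨a, c, C₁, A₀ + max B_Q (2 * Real.exp (2 * 1) * W), β₁, ℓ₁, P₀, p, hc, hle, hℓ₁, hC₁, hp,
    responseMoments_of_quadratic_and_influence (N := 2) (fundamentalLatticeRep 2) a 𝔟 ε kmax Q MQ hQm hQb hsplit hEMQ hW⟩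

end Unit

end Summit.QuantumFields.YangMills.Cruxes.UVSeamRec.TemperedResponse

end
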